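/-
Copyright: lit-balaban Phase-2 proof seat p30 (gen 9).  Statement-level skeleton of a published paper; no proof claims beyond what
the kernel checks below.
-/
import Literature.MathematicalPhysics.QuantumFieldTheory.BalabanImbrieJaffe1984to88.BIJ85ResidualSupBound
import Literature.MathematicalPhysics.QuantumFieldTheory.BalabanImbrieJaffe1984to88.BIJ85Prop12TorusBridge

/-!
# [BalabanImbrieJaffe1985] §7.3: the residual constant `K_R` of (7.3.1) ⇒ (7.3.2), HYPOTHESIS-FREE on every torus of `Setup`

T. Bałaban, J. Imbrie, A. Jaffe, *Renormalization of the Higgs model: minimizers, propagators and the stability of mean field theory*,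
Commun. Math. Phys. **97** (1985) 299–329 [BalabanImbrieJaffe1985].  Row **C1.Eq7.3.1-7.3.2** of the lit-balaban skeleton: the end of
this seat's chain.  `BIJ85ResidualSupBound` discharged the located input `K_R` of p33's closed-field residual route (`BIJ85Claim73Closed`)
from r15's typed (7.2.2), itself «a consequence of Proposition 1.2 and the representation (1.103) of [6I]» (p. 325); with [6I] Prop. 1.2
for p09's torus carrier now a THEOREM (`BIJ85Prop12TorusBridge.prop12Printed_torus`, from p37's `B5Prop12GHolds.prop12_famG_printed`
through the family bridge), the chain closes with NO cited input: for every torus of `Setup` (odd `L > 1`), every `a > 0` and every choice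
of scales `1 ≤ lev j ≤ m + K`, ONE `K_R` bounds the residual field of every CLOSED unit field at every scale (`exists_KR_eta`), and every
actual datum is an index of p33's `ClosedIdx d K_R 𝓅` (`closedIdx_total`, `closedIdx_total_levPos`) — so p33's `claim73_closed` is
(7.3.1) ⇒ (7.3.2) for the actual background (4.5.4) on that torus, unconditionally.  (Uniformity in the VOLUME as well — one `K_R` for all
tori of given `d`, `L` — is p33 g8's `BIJ85Claim73AllTori` fed with p19's all-tori export of Prop. 1.2.)

WHAT IS PROVED (0 `sorry`, theorems only, no `def`, no new named fact).  statement-level skeleton of published theorems with citation tags;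
proofs where landed; nothing here is a claim about the Yang–Mills mass gap.  Unit `lit-balaban-p30` (literature-prover-lit-balaban-p30-g9-0),
2026-08-21.
-/

namespace Literature.MathematicalPhysics.QuantumFieldTheory.BalabanImbrieJaffe1984to88.BIJ85ResidualKRFree

open Balaban1983to89 hiding Site Plaq
open BIJ85Sigma421Torus (toU)
open BIJ85Eq454PlaqResidual (resE)
open BIJ85Sect1Model (U1Field)
open BIJ85Claim73Closed (ClosedIdx)
open BIJ85UnitTorusHodge (IsClosedPlaq)
open BIJ85ResidualSupBound (exists_KR_eta_of_ineq722 closedIdx_total_of_prop12Printed)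
open BIJ85Prop12TorusBridge (prop12Printed_torus ineq722_deltaA levPos levPos_le one_le_levPos)
-- inside this namespace the bare `Site`/`Plaq` are the `ℤ^d` carriers of the QFT root; the torus ones are renamed:
open Balaban1983to89 renaming Site → TSite, Plaq → TPlaq

noncomputable section

variable {P : Params}

/-- **`K_R` HYPOTHESIS-FREE** (p33's normalisation `c = η⁻¹`, `w = η^d`): for every torus of `Setup`, every `a > 0` and every choice of
scales `1 ≤ lev j ≤ m + K` there is ONE `K_R ≥ 1` with `|resE(f)(p)| ≤ K_R·√(η^d)·s` at every scale of the family, for every CLOSED unit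
field `f` with `|f| ≤ s` — the typed (7.2.2) supplied by `BIJ85Prop12TorusBridge.ineq722_deltaA`. [cite: BalabanImbrieJaffe1985, (7.3.2) p.326] -/
theorem exists_KR_eta (hd : 2 ≤ P.d) {lev : ℕ → ℕ} (hlev : ∀ j, lev j ≤ P.m + P.K) (hlev1 : ∀ j, 1 ≤ lev j) {a : ℝ} (ha : 0 < a) :
    ∃ KR : ℝ, 1 ≤ KR ∧ ∀ (j : ℕ) (f : TPlaq P (lev j) → ℝ), IsClosedPlaq f → ∀ (s : ℝ), 0 ≤ s → (∀ q, |f q| ≤ s) →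
      ∀ p : TPlaq P 0,
        |resE hd ((P.eta (lev j)) ^ P.d) (P.eta (lev j))⁻¹ (lev j) (toU P (lev j) f) p| ≤
          KR * Real.sqrt ((P.eta (lev j)) ^ P.d) * s :=
  exists_KR_eta_of_ineq722 hd hlev ha
    (ineq722_deltaA hlev hlev1 ha (fun _ => PUnit) (fun _ _ _ => 0) (fun _ _ _ _ _ => 0) (fun _ _ _ => 0))

/-- **THE INDEX OF `BIJ85Claim73Closed` IS TOTAL, HYPOTHESIS-FREE**: for every torus of `Setup`, every `a > 0`, every exponent `𝓅` and
every choice of scales `1 ≤ lev j ≤ m + K` there is ONE `K_R ≥ 1` such that EVERY actual datum (scale `lev j`, coupling `0 < e ≤ 1` with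
`e𝓅(e) ≤ ½`, ANY unit `U(1)` field `v`) is an index of p33's `ClosedIdx P.d K_R 𝓅`; hence p33's `claim73_closed a ha K_R 𝓅` is
(7.3.1) ⇒ (7.3.2) for the actual background (4.5.4) on this torus with no cited input left. [cite: BalabanImbrieJaffe1985, (7.3.2) p.326] -/
theorem closedIdx_total (hd : 2 ≤ P.d) {lev : ℕ → ℕ} (hlev : ∀ j, lev j ≤ P.m + P.K) (hlev1 : ∀ j, 1 ≤ lev j) {a : ℝ}
    (ha : 0 < a) (pexp : ℝ) :
    ∃ KR : ℝ, 1 ≤ KR ∧ ∀ (j : ℕ), 1 ≤ lev j → ∀ (e : ℝ) (he : 0 < e) (he1 : e ≤ 1)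
      (hsmall : e * (1 + Real.log e⁻¹) ^ pexp ≤ 1 / 2) (v : U1Field P (lev j)),
      ∃ i : ClosedIdx P.d KR pexp, i.P = P ∧ i.k = lev j ∧ i.e = e ∧ HEq i.v v :=
  closedIdx_total_of_prop12Printed hd hlev ha (prop12Printed_torus hlev hlev1 ha) pexp

/-- **the same on the canonical positive range of scales** `levPos P j = max 1 (min j (m+K))` (every scale `1 ≤ k ≤ m + K` occurs,
`BIJ85Prop12TorusBridge.levPos_eq`), `1 ≤ m + K`. [cite: BalabanImbrieJaffe1985, (7.3.2) p.326] -/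
theorem closedIdx_total_levPos (hd : 2 ≤ P.d) (hmK : 1 ≤ P.m + P.K) {a : ℝ} (ha : 0 < a) (pexp : ℝ) :
    ∃ KR : ℝ, 1 ≤ KR ∧ ∀ (j : ℕ) (e : ℝ) (he : 0 < e) (he1 : e ≤ 1) (hsmall : e * (1 + Real.log e⁻¹) ^ pexp ≤ 1 / 2)
      (v : U1Field P (levPos P j)),
      ∃ i : ClosedIdx P.d KR pexp, i.P = P ∧ i.k = levPos P j ∧ i.e = e ∧ HEq i.v v := by
  obtain ⟨KR, hKR, h⟩ := closedIdx_total hd (levPos_le hmK) one_le_levPos ha pexp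
  exact ⟨KR, hKR, fun j => h j (one_le_levPos j)⟩

end

end Literature.MathematicalPhysics.QuantumFieldTheory.BalabanImbrieJaffe1984to88.BIJ85ResidualKRFree
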